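import Summits.SmoothPoincare4.SmoothPoincare4.Theorems.ConvexBisectionContractibleTwistedDoubleStandardStubSeam
import Summits.SmoothPoincare4.SmoothPoincare4.Theorems.ConvexBisectionAcyclicBisectionRigiditySeamGluing
import Literature.Barriers.SmoothPoincare4.ExoticContractibleSymmetryKillingCore
import Literature.Geometry.Symplectic.SteinOrientation
import Literature.Geometry.Symplectic.SteinBoundaryContactProofs
import Literature.Topology.FourManifolds.GluingProofs
import Literature.Topology.FourManifolds.MorseProofs
import HarnessLib

/-!
# The Mazur × Mazur sector of crux `ConvexBisection.ContractibleTwistedDoubleStandard`, Morse-theoretic half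
(stub `stub_mazurGluedProfile` of line `property-r-mazur-halves`, item stmt-SmoothPoincare4-3546)

**Theorem** (`stub_mazurGluedProfile`).  Let the closed smooth `4`-manifold `X` be a Stein bisection
`X = e₁(W₁) ∪ e₂(W₂)` of two compact contractible Stein domains along a common contact seam (the six
hypotheses of the crux).  If BOTH halves are smoothly of Mazur type — `W₁` and `W₂` carry Morse
functions `f₁`, `f₂` adapted to the boundary (Milnor 1965, Def. 3.1: `≡ 1` and regular on `∂W`, `< 1`
inside) with indices `≤ 2` and exactly one critical point of each index `0, 1, 2` — then `X` carries a
Morse function with exactly `1, 1, 2, 1, 1` critical points of index `0, 1, 2, 3, 4`.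

Proof.  The seam diffeomorphism `ψ : ∂W₁ ≅ ∂W₂` of the landed `LegendrianRKnotRigidity.stub_seam`
presents `X` as the boundary gluing `W₁ ∪_ψ W₂`, so the landed MORSE GLUING ACROSS THE SEAM
(`AcyclicBisectionRigidity.SeamGluing.exists_isMorse_of_bisection`, Milnor 1965 §1: glue `f₁` on `W₁`
with `2 - f₂` on `W₂`) gives a Morse function `F` on `X` with `#Crit_i(F) = c_i(f₁) + c_{4-i}(f₂)`;
since an index-`≤ 2` function has no critical points of index `3, 4`, the profile is
`(1+0, 1+0, 1+1, 0+1, 0+1) = (1,1,2,1,1)`.  Same pattern as the landed `stub_ballSectorMorse`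
(`…Theorems.ConvexBisectionContractibleTwistedDoubleStandardBallSectorMorse`), without the birth pair
and without orientability.

References: J. Milnor, *Lectures on the h-cobordism theorem* (1965), §1 and Def. 3.1.
-/

noncomputable section

-- the prescribed namespace duplicates SmoothPoincare4 (P = Sub)
set_option linter.dupNamespace false

open scoped Manifold ContDiff Topology
open Set Function Literature.Topology.FourManifolds Literature.Geometry.Symplectic

namespace Summit.SmoothPoincare4.SmoothPoincare4.Theorems.ContractibleTwistedDoubleStandard.PropertyRMazurHalves

/-- For a function on a `4`-manifold with boundary all of whose critical points have Morse index
`≤ 2`, the set of critical points of index `k ≥ 3` is empty, so has `ncard = 0`. [folklore] -/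
private theorem ncard_criticalSetOfIndex_eq_zero_of_index_le_two' {W : Type*} [TopologicalSpace W]
    [ChartedSpace (EuclideanHalfSpace 4) W] {f : W → ℝ}
    (hi : ∀ z, IsMCriticalPt (𝓡∂ 4) f z → morseIndex (𝓡∂ 4) f z ≤ 2) {k : ℕ} (hk : 3 ≤ k) :
    (criticalSetOfIndex (𝓡∂ 4) f k).ncard = 0 := by
  have he : criticalSetOfIndex (𝓡∂ 4) f k = ∅ := by
    refine eq_empty_of_forall_notMem fun x hx => ?_
    have := hi x hx.1
    rw [hx.2] at this
    omega
  rw [he, ncard_empty]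

/-- **Stub `stub_mazurGluedProfile` (the Mazur × Mazur sector, Morse-theoretic half; NEW in
skeleton m8).**  For a crux bisection `X = e₁(W₁) ∪ e₂(W₂)` (two compact contractible Stein domains,
smoothly embedded, covering `X`, meeting exactly along both boundary images, contact planes matched)
with BOTH halves smoothly Mazur (adapted Morse functions `f₁`, `f₂` with indices `≤ 2` and exactly
one critical point of each index `0, 1, 2`), `X` carries a Morse function with exactly `1, 1, 2, 1, 1`
critical points of index `0, 1, 2, 3, 4`: the seam map of `stub_seam` presents `X` as `W₁ ∪_ψ W₂` and
the two functions glue across the seam with profile `c_i(f₁) + c_{4-i}(f₂)`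
(`SeamGluing.exists_isMorse_of_bisection`), i.e. `(1+0, 1+0, 1+1, 0+1, 0+1)`.
[cite: MilnorHCobordism1965, §1 and Def. 3.1] -/
theorem stub_mazurGluedProfile :
    ∀ (X : Type) [TopologicalSpace X] [T2Space X] [SecondCountableTopology X] [CompactSpace X]
      [ChartedSpace (EuclideanSpace ℝ (Fin 4)) X] [IsManifold (𝓡 4) ∞ X]
      (W₁ : Type) [TopologicalSpace W₁] [ChartedSpace (EuclideanHalfSpace 4) W₁]
      [IsManifold (𝓡∂ 4) ∞ W₁] [CompactSpace W₁] [ContractibleSpace W₁]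
      (W₂ : Type) [TopologicalSpace W₂] [ChartedSpace (EuclideanHalfSpace 4) W₂]
      [IsManifold (𝓡∂ 4) ∞ W₂] [CompactSpace W₂] [ContractibleSpace W₂]
      (J₁ : SteinStructure W₁) (J₂ : SteinStructure W₂) (e₁ : W₁ → X) (e₂ : W₂ → X),
      Manifold.IsSmoothEmbedding (𝓡∂ 4) (𝓡 4) ∞ e₁ → Manifold.IsSmoothEmbedding (𝓡∂ 4) (𝓡 4) ∞ e₂ →
      Set.range e₁ ∪ Set.range e₂ = Set.univ →
      Set.range e₁ ∩ Set.range e₂ = e₁ '' (𝓡∂ 4).boundary W₁ →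
      Set.range e₁ ∩ Set.range e₂ = e₂ '' (𝓡∂ 4).boundary W₂ →
      (∀ w₁ w₂, e₁ w₁ = e₂ w₂ →
        Submodule.map (mfderiv (𝓡∂ 4) (𝓡 4) e₁ w₁).toLinearMap (contactPlane J₁.J w₁) =
          Submodule.map (mfderiv (𝓡∂ 4) (𝓡 4) e₂ w₂).toLinearMap (contactPlane J₂.J w₂)) →
      ∀ (f₁ : W₁ → ℝ), IsMorseAdapted (𝓡∂ 4) f₁ →
      (∀ z, IsMCriticalPt (𝓡∂ 4) f₁ z → morseIndex (𝓡∂ 4) f₁ z ≤ 2) →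
      (criticalSetOfIndex (𝓡∂ 4) f₁ 0).ncard = 1 → (criticalSetOfIndex (𝓡∂ 4) f₁ 1).ncard = 1 →
      (criticalSetOfIndex (𝓡∂ 4) f₁ 2).ncard = 1 →
      ∀ (f₂ : W₂ → ℝ), IsMorseAdapted (𝓡∂ 4) f₂ →
      (∀ z, IsMCriticalPt (𝓡∂ 4) f₂ z → morseIndex (𝓡∂ 4) f₂ z ≤ 2) →
      (criticalSetOfIndex (𝓡∂ 4) f₂ 0).ncard = 1 → (criticalSetOfIndex (𝓡∂ 4) f₂ 1).ncard = 1 →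
      (criticalSetOfIndex (𝓡∂ 4) f₂ 2).ncard = 1 →
        ∃ F : X → ℝ, IsMorse (𝓡 4) F ∧
          (criticalSetOfIndex (𝓡 4) F 0).ncard = 1 ∧ (criticalSetOfIndex (𝓡 4) F 1).ncard = 1 ∧
          (criticalSetOfIndex (𝓡 4) F 2).ncard = 2 ∧ (criticalSetOfIndex (𝓡 4) F 3).ncard = 1 ∧
          (criticalSetOfIndex (𝓡 4) F 4).ncard = 1 := by
  intro X _ _ _ _ _ _ W₁ _ _ _ _ _ W₂ _ _ _ _ _ J₁ J₂ e₁ e₂ h1 h2 hcov hL hR hC f₁ hf₁ hi1 h10 h11 h12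
    f₂ hf₂ hi2 h20 h21 h22
  -- separation and countability of the halves (embedded in `X`)
  haveI : T2Space W₁ := h1.isEmbedding.t2Space
  haveI : T2Space W₂ := h2.isEmbedding.t2Space
  haveI : SecondCountableTopology W₁ := h1.isEmbedding.secondCountableTopology
  haveI : SecondCountableTopology W₂ := h2.isEmbedding.secondCountableTopology
  -- boundary data and the seam diffeomorphism
  obtain ⟨b₁⟩ := nonempty_boundaryData_holds 3 W₁
  obtain ⟨b₂⟩ := nonempty_boundaryData_holds 3 W₂
  obtain ⟨ψ, hψ, -⟩ := LegendrianRKnotRigidity.stub_seam X W₁ W₂ J₁ J₂ e₁ e₂ h1 h2 hL hR hC b₁ b₂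
  -- the seam is nonempty: the `J`-convex function of `W₁ ≠ ∅` attains its maximum on `∂W₁`
  haveI : Nonempty b₁.carrier := by
    obtain ⟨x, hx⟩ := J₁.exists_isBoundaryPoint
    have hx' : x ∈ range b₁.incl := by rw [b₁.range_incl]; exact hx
    obtain ⟨z, -⟩ := hx'
    exact ⟨z⟩
  -- Morse gluing across the seam: `#Crit_i(F) = c_i(f₁) + c_{4-i}(f₂)`
  obtain ⟨F, hF, hcount⟩ :=
    AcyclicBisectionRigidity.SeamGluing.exists_isMorse_of_bisection h1 h2 hcov hL b₁ b₂ ψ hψ hf₁ hf₂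
  refine ⟨F, hF, ?_, ?_, ?_, ?_, ?_⟩
  · rw [hcount 0 4 rfl, h10, ncard_criticalSetOfIndex_eq_zero_of_index_le_two' hi2 (by norm_num)]
  · rw [hcount 1 3 rfl, h11, ncard_criticalSetOfIndex_eq_zero_of_index_le_two' hi2 le_rfl]
  · rw [hcount 2 2 rfl, h12, h22]
  · rw [hcount 3 1 rfl, ncard_criticalSetOfIndex_eq_zero_of_index_le_two' hi1 le_rfl, h21]
  · rw [hcount 4 0 rfl, ncard_criticalSetOfIndex_eq_zero_of_index_le_two' hi1 (by norm_num), h20]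

end Summit.SmoothPoincare4.SmoothPoincare4.Theorems.ContractibleTwistedDoubleStandard.PropertyRMazurHalves

end
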